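import Summits.Ventures.PercRepro.C041MultiExitMain
import Summits.Ventures.PercRepro.C041TwoExitMain

/-!
# ROW C-041 — THEOREM (TWO-EXIT BLOCK MAP) IS THE CASE `r = 2` OF THE GENERAL BLOCK MAP (p6, gen 33)

Setting of `C041MultiExitMain` with the exits indexed by `Bool` (`ex2 u u'`: `u` at `false`, `u'` at `true`).  For
each of the five status patterns of two exits (both merged; one merged; both separated in one block; both
separated apart) the merged set and the blocks are computed (`merged_ex2_*`, `blocks_ex2_*`), and the summand of
the block map is `C041TwoExitSix`'s `contrib` (`blockMap_ex2`).  Hence THEOREM (TWO-EXIT BLOCK MAP) `sixVec_glue2`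
of `C041TwoExitMain` reads: the six-vector of the `Sum`-typed two-exit attachment `glue2` is the block map of the
host with two exits evaluated at the two six-vectors (`sixVec_glue2_eq_blockMap`) — the general theorem's formula
with `r = 2`, without any transport between the two constructions.
-/

namespace PercRepro

namespace ZoneZ

namespace MultiExit

open ZoneData Pendant Finset TwoExit TreeClosure

variable {V₁ E₁ U₁ U₂ : Type} (Z₁ : ZoneData V₁ E₁ U₁ U₂) (u u' a₁ : V₁)

/-- Two exits indexed by `Bool`: `u` at `false`, `u'` at `true`. -/
def ex2 : Bool → V₁ := fun b => if b then u' else u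

/-- The exit at `false`. -/
theorem ex2_false : ex2 u u' false = u := rfl
/-- The exit at `true`. -/
theorem ex2_true : ex2 u u' true = u' := rfl

variable (ω : E₁ → Bool)

/-! ## The merged set and the blocks in the five status patterns -/

/-- Both merged: every exit is merged. -/
theorem merged_ex2_mm (hm : Z₁.Mg a₁ u ω) (hm' : Z₁.Mg a₁ u' ω) : merged Z₁ (ex2 u u') a₁ ω = univ := by
  rw [Finset.eq_univ_iff_forall]
  intro b
  rw [mem_merged]
  cases b
  · exact hm
  · exact hm'

/-- Both merged: no block. -/
theorem blocks_ex2_mm (hm : Z₁.Mg a₁ u ω) (hm' : Z₁.Mg a₁ u' ω) : blocks Z₁ (ex2 u u') a₁ ω = ∅ := by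
  rw [Finset.eq_empty_iff_forall_notMem]
  intro B hB
  obtain ⟨b, hb, -⟩ := (mem_blocks Z₁ (ex2 u u') a₁ ω B).1 hB
  cases b
  · exact hb hm
  · exact hb hm'

/-- `u` merged, `u'` separated: the merged set is `{false}`. -/
theorem merged_ex2_ms (hm : Z₁.Mg a₁ u ω) (hm' : ¬ Z₁.Mg a₁ u' ω) : merged Z₁ (ex2 u u') a₁ ω = {false} := by
  ext b
  rw [mem_merged, Finset.mem_singleton]
  cases b
  · simp [ex2, hm]
  · simp [ex2, hm']

/-- `u` merged, `u'` separated: one block `{true}`. -/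
theorem blocks_ex2_ms (hm : Z₁.Mg a₁ u ω) (hm' : ¬ Z₁.Mg a₁ u' ω) : blocks Z₁ (ex2 u u') a₁ ω = {{true}} := by
  have hblk : blk Z₁ (ex2 u u') a₁ ω true = {true} := by
    ext c
    rw [mem_blk, Finset.mem_singleton]
    cases c
    · simp [ex2, hm]
    · simp [ex2, hm', Mg_refl]
  ext B
  rw [mem_blocks, Finset.mem_singleton]
  constructor
  · rintro ⟨b, hb, rfl⟩
    cases b
    · exact absurd hm hb
    · exact hblk
  · rintro rfl
    exact ⟨true, hm', hblk⟩

/-- `u` separated, `u'` merged: the merged set is `{true}`. -/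
theorem merged_ex2_sm (hm : ¬ Z₁.Mg a₁ u ω) (hm' : Z₁.Mg a₁ u' ω) : merged Z₁ (ex2 u u') a₁ ω = {true} := by
  ext b
  rw [mem_merged, Finset.mem_singleton]
  cases b
  · simp [ex2, hm]
  · simp [ex2, hm']

/-- `u` separated, `u'` merged: one block `{false}`. -/
theorem blocks_ex2_sm (hm : ¬ Z₁.Mg a₁ u ω) (hm' : Z₁.Mg a₁ u' ω) : blocks Z₁ (ex2 u u') a₁ ω = {{false}} := by
  have hblk : blk Z₁ (ex2 u u') a₁ ω false = {false} := by
    ext c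
    rw [mem_blk, Finset.mem_singleton]
    cases c
    · simp [ex2, hm, Mg_refl]
    · simp [ex2, hm']
  ext B
  rw [mem_blocks, Finset.mem_singleton]
  constructor
  · rintro ⟨b, hb, rfl⟩
    cases b
    · exact hblk
    · exact absurd hm' hb
  · rintro rfl
    exact ⟨false, hm, hblk⟩

/-- Both separated: no exit is merged. -/
theorem merged_ex2_ss (hm : ¬ Z₁.Mg a₁ u ω) (hm' : ¬ Z₁.Mg a₁ u' ω) : merged Z₁ (ex2 u u') a₁ ω = ∅ := by
  rw [Finset.eq_empty_iff_forall_notMem]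
  intro b hb
  rw [mem_merged] at hb
  cases b
  · exact hm hb
  · exact hm' hb

/-- Both separated, blue-connected: one block of both exits. -/
theorem blocks_ex2_joint (hm : ¬ Z₁.Mg a₁ u ω) (hm' : ¬ Z₁.Mg a₁ u' ω) (hbc : Z₁.Mg u u' ω) :
    blocks Z₁ (ex2 u u') a₁ ω = {univ} := by
  have hblk : ∀ b, blk Z₁ (ex2 u u') a₁ ω b = univ := by
    intro b
    rw [Finset.eq_univ_iff_forall]
    intro c
    rw [mem_blk]
    cases b <;> cases c
    · exact ⟨hm, Mg_refl Z₁ ω u⟩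
    · exact ⟨hm', hbc⟩
    · exact ⟨hm, Mg_symm Z₁ ω _ _ hbc⟩
    · exact ⟨hm', Mg_refl Z₁ ω u'⟩
  ext B
  rw [mem_blocks, Finset.mem_singleton]
  constructor
  · rintro ⟨b, -, rfl⟩
    exact hblk b
  · rintro rfl
    exact ⟨false, hm, hblk false⟩

/-- Both separated, apart: two singleton blocks. -/
theorem blocks_ex2_apart (hm : ¬ Z₁.Mg a₁ u ω) (hm' : ¬ Z₁.Mg a₁ u' ω) (hbc : ¬ Z₁.Mg u u' ω) :
    blocks Z₁ (ex2 u u') a₁ ω = {{false}, {true}} := by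
  have hf : blk Z₁ (ex2 u u') a₁ ω false = {false} := by
    ext c
    rw [mem_blk, Finset.mem_singleton]
    cases c
    · simp [ex2, hm, Mg_refl]
    · simp [ex2, hbc]
  have hbc' : ¬ Z₁.Mg u' u ω := fun h => hbc (Mg_symm Z₁ ω _ _ h)
  have ht : blk Z₁ (ex2 u u') a₁ ω true = {true} := by
    ext c
    rw [mem_blk, Finset.mem_singleton]
    cases c
    · simp [ex2, hm, hbc']
    · simp [ex2, hm', Mg_refl]
  ext B
  rw [mem_blocks, Finset.mem_insert, Finset.mem_singleton]
  constructor
  · rintro ⟨b, -, rfl⟩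
    cases b
    · exact Or.inl hf
    · exact Or.inr ht
  · rintro (rfl | rfl)
    · exact ⟨false, hm, hf⟩
    · exact ⟨true, hm', ht⟩

/-! ## The block map with two exits is the two-exit contribution -/

variable [Fintype E₁] [DecidableEq E₁]

/-- **The block map with two exits** is the sum over the colourings of `C041TwoExitSix`'s `contrib`. -/
theorem blockMap_ex2 (w : Bool → Vec6) :
    blockMap Z₁ (ex2 u u') a₁ w = ∑ ω : E₁ → Bool,
      contrib (w false) (w true) (Z₁.Mg a₁ u ω) (Z₁.Rd a₁ u ω) (Z₁.Mg a₁ u' ω) (Z₁.Rd a₁ u' ω) (Z₁.Mg u u' ω) := by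
  unfold blockMap
  refine Finset.sum_congr rfl fun ω _ => ?_
  unfold contrib
  by_cases hm : Z₁.Mg a₁ u ω <;> by_cases hm' : Z₁.Mg a₁ u' ω
  · rw [if_pos hm, if_pos hm', merged_ex2_mm Z₁ u u' a₁ ω hm hm', blocks_ex2_mm Z₁ u u' a₁ ω hm hm',
      Finset.prod_empty, mul_one, Fintype.prod_bool, ex2_true, ex2_false, mul_comm]
  · rw [if_pos hm, if_neg hm', merged_ex2_ms Z₁ u u' a₁ ω hm hm', blocks_ex2_ms Z₁ u u' a₁ ω hm hm',
      Finset.prod_singleton, Finset.prod_singleton, Finset.prod_singleton, ex2_true, ex2_false]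
  · rw [if_neg hm, if_pos hm', merged_ex2_sm Z₁ u u' a₁ ω hm hm', blocks_ex2_sm Z₁ u u' a₁ ω hm hm',
      Finset.prod_singleton, Finset.prod_singleton, Finset.prod_singleton, ex2_true, ex2_false, mul_comm]
  · rw [if_neg hm, if_neg hm', merged_ex2_ss Z₁ u u' a₁ ω hm hm', Finset.prod_empty, one_mul]
    by_cases hbc : Z₁.Mg u u' ω
    · rw [if_pos hbc, blocks_ex2_joint Z₁ u u' a₁ ω hm hm' hbc, Finset.prod_singleton, Fintype.prod_bool,
        ex2_true, ex2_false, mul_comm]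
    · rw [if_neg hbc, blocks_ex2_apart Z₁ u u' a₁ ω hm hm' hbc,
        Finset.prod_insert (by simp), Finset.prod_singleton, Finset.prod_singleton, Finset.prod_singleton,
        ex2_true, ex2_false]

/-- **THEOREM (TWO-EXIT BLOCK MAP) as the case `r = 2` of the general block map**: the six-vector of the
`Sum`-typed two-exit attachment `glue2 Z₁ u u' Z a Z' a'` is the block map of the host with the two exits,
evaluated at the six-vectors of the two zones. -/
theorem sixVec_glue2_eq_blockMap {V E T₁ T₂ V' E' T₁' T₂' : Type} (Z : ZoneData V E T₁ T₂) (a : V)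
    (Z' : ZoneData V' E' T₁' T₂') (a' : V') [Fintype E] [DecidableEq E] [Fintype T₁] [DecidableEq T₁]
    [Fintype T₂] [DecidableEq T₂] [Fintype E'] [DecidableEq E'] [Fintype T₁'] [DecidableEq T₁'] [Fintype T₂']
    [DecidableEq T₂'] :
    (glue2 Z₁ u u' Z a Z' a').sixVec (Sum.inl (Sum.inl a₁)) =
      blockMap Z₁ (ex2 u u') a₁ fun b => if b then Z'.sixVec a' else Z.sixVec a := by
  rw [sixVec_glue2, blockMap_ex2]
  simp only [Bool.false_eq_true, if_false, if_true]

end MultiExit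

end ZoneZ

end PercRepro
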